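import Literature.NumberTheory.EllipticCurves.SelmerTorsionCMOperatorJZero
import HarnessLib

/-!
# The `[ζ]`-data existence package for a short `j = 0` model

For the (L3) ASSEMBLY of crux `UpperOffV0HSYPlus` (stmt-BirchSwinnertonDyer-19804) at `p = 2`:
k7t-c3x's instantiation theorems `SylvesterTwoCoupledDescentCebotarev.hsy_curve_package`,
`hsy_exists_moving`, `infinite_kolyvaginPrimes_ne_hsy`, `infinite_kolyvaginPrimes_line_hsy`
(`…CoupledDescentCebotarevHSY`, `…CebotarevHSYClauses`) take, per curve `X = ⟨0,0,0,0,b⟩` over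
`ℚ` base-changed to a number field `K ∋ ζ` (`ζ` a primitive cube root of unity), SIX DISPLAYED
binders `φ / hφrel / hφ / fn / hfn / hcoe`: an additive self-map `φ` of `X_K(K̄)` with
`φ² + φ + 1 = 0` acting as `(x, y) ↦ (ζ² x, y)` on affine points, and its Galois-equivariant
restriction `fn` to the `n`-torsion (`↑(fn P) = φ ↑P`). This file DISCHARGES those binders: they
exist (planner D418, NARROWED GO #10′), by k-ty1's `JZero.exists_cm_isogeny_of_eq` (p615303: the
CM isogeny `[ζ]` of `y² = x³ + b`) and `AddMonoidHom.codRestrict` to `X_K[n]` (an isogeny is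
Galois-equivariant and additive, so it preserves `X_K[n]`). Stated for every level `n : ℤ`
(`exists_cm_data`) and at the level `((2 : ℕ) : ℤ)` of the (L3) files (`exists_cm_data_two`), with
the binder types copied verbatim from `hsy_curve_package`. Theorem-only; nothing asserted on
19804; no label moves; BSD not claimed for any curve.
-/

set_option linter.dupNamespace false -- Summits modules are `Summit.<Summit>.<Problem>…` by design

noncomputable section

open scoped Classical
open WeierstrassCurve Field
open Literature.NumberTheory.EllipticCurves Literature.NumberTheory.GaloisRepresentations

namespace Summit.BirchSwinnertonDyer.BirchSwinnertonDyer.Theorems.SylvesterTwoCoupledDescentF4Package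

variable {K : Type} [Field K] [NumberField K] (X : WeierstrassCurve ℚ)

/-- `(X⁄K) = ⟨0,0,0,0, a₆⟩` for a short `j = 0` model (k-ty1's private lemma, re-proved). -/
theorem baseChange_eq_of_a_eq_zero (ha₁ : X.a₁ = 0) (ha₂ : X.a₂ = 0) (ha₃ : X.a₃ = 0)
    (ha₄ : X.a₄ = 0) : X.baseChange K = ⟨0, 0, 0, 0, algebraMap ℚ K X.a₆⟩ := by
  ext
  · change algebraMap ℚ K X.a₁ = 0; rw [ha₁, map_zero]
  · change algebraMap ℚ K X.a₂ = 0; rw [ha₂, map_zero]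
  · change algebraMap ℚ K X.a₃ = 0; rw [ha₃, map_zero]
  · change algebraMap ℚ K X.a₄ = 0; rw [ha₄, map_zero]
  · rfl

variable [X.IsElliptic]

/-- **The `[ζ]`-data exist, every level `n`.** For a short model `X = ⟨0,0,0,0,b⟩` over `ℚ`, a
number field `K` and a primitive cube root of unity `ζ ∈ K`: there are an additive self-map `φ`
of `X_K(K̄)` with `φ (φ P) + φ P + P = 0`, acting on affine points by `(x, y) ↦ (ζ² x, y)`, and an
additive self-map `fn` of the `n`-torsion `X_K[n]`, Galois-equivariant (in the
`ContinuousMonoidHom.id`-twisted shape consumed by `resH1Hom`) and restricting `φ`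
(`↑(fn P) = φ ↑P`). Construction: `φ :=` the CM isogeny of `JZero.exists_cm_isogeny_of_eq`
(as an additive map), `fn :=` its `codRestrict` to `X_K[n]`. -/
theorem exists_cm_data (ha₁ : X.a₁ = 0) (ha₂ : X.a₂ = 0) (ha₃ : X.a₃ = 0) (ha₄ : X.a₄ = 0)
    {ζ : K} (hζ : IsPrimitiveRoot ζ 3) (n : ℤ) :
    ∃ (φ : geomPoints (X.baseChange K) →+ geomPoints (X.baseChange K))
      (fn : geomTorsion (X.baseChange K) n →+ geomTorsion (X.baseChange K) n),
      (∀ P, φ (φ P) + φ P + P = 0) ∧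
      (∀ (x y : AlgebraicClosure K)
        (h : ((X.baseChange K).baseChange (AlgebraicClosure K)).toAffine.Nonsingular x y),
        ∃ h', φ (Affine.Point.some x y h) =
          Affine.Point.some (algebraMap K (AlgebraicClosure K) ζ ^ 2 * x) y h') ∧
      (∀ (σ : absoluteGaloisGroup K) (P : geomTorsion (X.baseChange K) n),
        fn (ContinuousMonoidHom.id _ σ • P) = σ • fn P) ∧
      (∀ P : geomTorsion (X.baseChange K) n,
        ((fn P : geomTorsion (X.baseChange K) n) : geomPoints (X.baseChange K)) = φ P) := by
  have hV := baseChange_eq_of_a_eq_zero (K := K) X ha₁ ha₂ ha₃ ha₄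
  obtain ⟨φ, hφ, hrel⟩ := JZero.exists_cm_isogeny_of_eq (V := X.baseChange K) hV hζ
  let fn : geomTorsion (X.baseChange K) n →+ geomTorsion (X.baseChange K) n :=
    (φ.toAddMonoidHom.comp (geomTorsion (X.baseChange K) n).subtype).codRestrict _ fun P ↦ by
      simp only [AddMonoidHom.coe_comp, AddSubgroup.coe_subtype, Function.comp_apply]
      rw [mem_geomTorsion_iff, ← map_zsmul, (mem_geomTorsion_iff _ _ _).mp P.2, map_zero]
  have hcoe : ∀ P : geomTorsion (X.baseChange K) n,
      ((fn P : geomTorsion (X.baseChange K) n) : geomPoints (X.baseChange K)) = φ P :=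
    fun _ ↦ rfl
  refine ⟨φ.toAddMonoidHom, fn, hrel, hφ, fun g P ↦ ?_, hcoe⟩
  apply Subtype.ext
  rw [hcoe, AddSubgroup.torsionBy.coe_smul, AddSubgroup.torsionBy.coe_smul, hcoe]
  exact φ.equivariant g P

/-- **The `[ζ]`-data exist at level `2`** — `exists_cm_data` at `n := ((2 : ℕ) : ℤ)`, the level
and binder types of `hsy_curve_package` / `hsy_exists_moving` /
`infinite_kolyvaginPrimes_ne_hsy` / `infinite_kolyvaginPrimes_line_hsy` verbatim (so that
`obtain ⟨φ, fn, hφrel, hφ, hfn, hcoe⟩ := exists_cm_data_two X h1 h2 h3 h4 hζ` supplies their six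
per-curve binders). -/
theorem exists_cm_data_two (ha₁ : X.a₁ = 0) (ha₂ : X.a₂ = 0) (ha₃ : X.a₃ = 0) (ha₄ : X.a₄ = 0)
    {ζ : K} (hζ : IsPrimitiveRoot ζ 3) :
    ∃ (φ : geomPoints (X.baseChange K) →+ geomPoints (X.baseChange K))
      (fn : geomTorsion (X.baseChange K) ((2 : ℕ) : ℤ) →+
        geomTorsion (X.baseChange K) ((2 : ℕ) : ℤ)),
      (∀ P, φ (φ P) + φ P + P = 0) ∧
      (∀ (x y : AlgebraicClosure K)
        (h : ((X.baseChange K).baseChange (AlgebraicClosure K)).toAffine.Nonsingular x y),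
        ∃ h', φ (Affine.Point.some x y h) =
          Affine.Point.some (algebraMap K (AlgebraicClosure K) ζ ^ 2 * x) y h') ∧
      (∀ (σ : absoluteGaloisGroup K) (P : geomTorsion (X.baseChange K) ((2 : ℕ) : ℤ)),
        fn (ContinuousMonoidHom.id _ σ • P) = σ • fn P) ∧
      (∀ P : geomTorsion (X.baseChange K) ((2 : ℕ) : ℤ),
        ((fn P : geomTorsion (X.baseChange K) ((2 : ℕ) : ℤ)) : geomPoints (X.baseChange K)) =
          φ P) :=
  exists_cm_data (K := K) X ha₁ ha₂ ha₃ ha₄ hζ ((2 : ℕ) : ℤ)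

end Summit.BirchSwinnertonDyer.BirchSwinnertonDyer.Theorems.SylvesterTwoCoupledDescentF4Package

end
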